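import Summits.BirchSwinnertonDyer.Rank1Residual.Additive.RankOneUpperHalfDescentCount
import Summits.BirchSwinnertonDyer.Rank1Residual.Additive.CensusX42ValBridges
import HarnessLib

/-!
# (S11-c) / (S11-d) SHA-squared rank-ONE class corollaries by first-descent COUNT — the EVEN branch
# and the WINDOW-grade (valuation-relation) forms (cell `b2b-bsdres`, team n1011, seat p16 GEN 5 draft,
# filed by p16 GEN 6 as row T-S11cd: route planner 3's optional (S11-c)/(S11-d), ROUTE-3 l.103;
# RATIFIED under the idle rule by lead GEN 7, R5-65 (k′); r3 GEN 19 first say: no objection)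

HONEST FRAMING (cell `b2b-bsdres`, run/shared/lean/b2b/bsd-rank1-residual/, verbatim in every
file): the goal of the cell is to DELETE the COMBINATION-SHAPED residual classes of the
Birch–Swinnerton-Dyer formula for ALL analytic-rank `≤ 1` elliptic curves over `ℚ` — "full BSD
formula for every rank `≤ 1` curve in class `C`" assembled STRICTLY from published theorems — so
that the rank-`≤ 1` remainder becomes exactly the CONSTRUCTION-SHAPED classes, which are TYPED
(missing-input `Prop`s), NOT attempted. This is not "finishing BSD". Team n1011 (N10 / N11 / O7),
seat p16: research route; X4 stays CONSTRUCTION-SHAPED; closes NO class; nothing is booked; no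
Literature fact is minted. Theorems only; each ONE term over landed names.

* (S11-c) `ClassX4Gord.bsdp_rankOne_of_katoHalf_of_schneider_of_branchPAdicGrossZagier_of_casselsTate_of_sq_dvd_card_selmerGroup`
  — even branch `p ≡ 1 (mod 4)` (UPPER = p01's `…_of_katoHalf_of_schneider_of_branchPAdicGrossZagier`);
* (S11-d) `ClassX4Gord.bsdp[_three]_rankOne_of_katoHalf_of_censusX42Val_of_casselsTate_of_sq_dvd_card_selmerGroup`,
  `ClassX4M.bsdp_rankOne_of_katoHalf_of_censusX42Val_of_casselsTate_of_sq_dvd_card_selmerGroup` — the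
  rider `hS` and the branch `p`-adic Gross–Zagier `hGZ` REPLACED by the census VALUATION relation at
  the pair `hrel : CensusX42.ValRelationAt W p Dh` (WINDOW grade) through census-ctyper1's ValBridges
  (`schneider_of_valRelationAt[_mult]`, `branchPAdicGrossZagier[Odd|Mult]At_of_valRelationAt`; GZ
  I.(7.3) `hGZ'` enters there), exactly as p271513 does on the unit rows.
All four theorems are POINTWISE (ONE `Dh` carries `hB` and `hS`/`hGZ` resp. `hrel`; no `∀ Dh`
packaging), hence outside census-ctyper1's exact-grade erratum (INBOX l.5092) and route planner 3's
anomalous-row rider (ROUTE-3 l.114; cell rule R5-65 (m)); per pair; they close NO class.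
References: [Kato2004Asterisque] Thm. 17.4; [Delbourgo2002] Thm. (B); [GrossZagier1986] Thm. I.(7.3);
[SilvermanAEC2009] Thm. X.4.14; [Miller2011LMS] Def. 1.1.
-/

noncomputable section

open scoped Classical MatrixGroups ModularForm NumberField

open CongruenceSubgroup WeierstrassCurve NumberField Literature.NumberTheory.EllipticCurves
  Literature.NumberTheory.EllipticCurves.ModularForms
  Literature.NumberTheory.EllipticCurves.Rank1Residual
  Literature.NumberTheory.EllipticCurves.Rank1Residual.Typed
  Literature.NumberTheory.EllipticCurves.Delbourgo2002

namespace Summit.BirchSwinnertonDyer.Rank1Residual.Additive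

open Supersingular CensusX42

variable {W : WeierstrassCurve ℚ} [W.IsElliptic] [W.IsGloballyMinimal] {p : ℕ} [hp : Fact p.Prime]

omit [W.IsElliptic] [W.IsGloballyMinimal] in
/-- An odd prime is `≡ 1` or `≡ 3 (mod 4)`. [folklore] -/
private theorem mod_four_eq_one_or_three_of_ne_two (hp2 : p ≠ 2) : p % 4 = 1 ∨ p % 4 = 3 := by
  obtain ⟨k, hk⟩ := hp.out.odd_of_ne_two hp2
  omega

/-- **(S11-c) X4♯(G-ord, `e = 2`) ∧ surj, `r_an = 1`, `p ≡ 1 (mod 4)`, `ord_p #Ш_an(E) ≤ 2`, certificate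
`p² ∣ #Sel^(p)(E/ℚ)`: `BSD(E,p)`** — even branch: UPPER = p01's
`ClassX4Gord.missingUpperBoundAt_rankOne_of_katoHalf_of_schneider_of_branchPAdicGrossZagier` (`hK`, `hB`,
rider `hS`, typed `hGZ : BranchPAdicGrossZagierAt`), LOWER = Cassels–Tate + the count through p273823.
[cite: Kato2004Asterisque, Thm. 17.4] [cite: Delbourgo2002, Theorem (B) (p. 40)]
[cite: SilvermanAEC2009, Thm. X.4.14] [cite: Miller2011LMS, Def. 1.1] -/
theorem ClassX4Gord.bsdp_rankOne_of_katoHalf_of_schneider_of_branchPAdicGrossZagier_of_casselsTate_of_sq_dvd_card_selmerGroup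
    (hK : Wuthrich2014.kato_halfEigenCharIdeal_dvd_cyclotomicPrime_of_surjective)
    (hCT : exists_casselsTate_pairing (K := ℚ))
    (hGZK : rank_eq_analyticRank_of_analyticRank_le_one) (hmod : hasEntireLFunction_rat)
    (hmodD : nonempty_modularParametrizationData) (hX : ClassX4Gord W p)
    (he : semistabilityIndex W p = 2) (hp4 : p % 4 = 1) (hsurj : Surj W p) (hr : W.analyticRank = 1)
    {Dh : PAdicHeightData W p} (hB : LeadingTermClauses W p Dh) (hS : SchneiderConjecture Dh)
    (hGZ : BranchPAdicGrossZagierAt W p Dh) {q : ℚ} (hq : shaAn W = (q : ℂ))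
    (hv : padicValRat p q ≤ 2) (hcard : p ^ 2 ∣ Nat.card (W.selmerGroup (p : ℤ))) :
    BSDp W p :=
  bsdp_of_missingUpperBoundAt_of_casselsTate_of_card_selmerGroup W p hCT hGZK (by rw [hr])
    (not_dvd_torsionOrder_of_irr W p hX.1.2.2) hq hv (by rw [hr]; exact hcard)
    (ClassX4Gord.missingUpperBoundAt_rankOne_of_katoHalf_of_schneider_of_branchPAdicGrossZagier hK hGZK
      hmod hmodD hX he hp4 hsurj hr hB hS hGZ)

/-- **(S11-d) X4♯(G-ord, `e = 2`) ∧ surj, `r_an = 1`, EVERY odd `p`, `ord_p #Ш_an(E) ≤ 2`, certificate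
`p² ∣ #Sel^(p)(E/ℚ)`, at WINDOW grade:** Kato's half `hK` + a (B)-datum `Dh` (`hB`) + the census
VALUATION relation at the pair `hrel : ValRelationAt W p Dh` (which yields the rider and the branch
`p`-adic Gross–Zagier, ValBridges; GZ I.(7.3) `hGZ'`) + Cassels–Tate + the count ⟹ `BSD(E,p)`.
[cite: Kato2004Asterisque, Thm. 17.4 (3) (p. 273)] [cite: Delbourgo2002, Theorem (B) (p. 40)]
[cite: GrossZagier1986, Thm. I.(7.3)] [cite: SilvermanAEC2009, Thm. X.4.14] [cite: Miller2011LMS, Def. 1.1] -/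
theorem ClassX4Gord.bsdp_rankOne_of_katoHalf_of_censusX42Val_of_casselsTate_of_sq_dvd_card_selmerGroup
    (hK : Wuthrich2014.kato_halfEigenCharIdeal_dvd_cyclotomicPrime_of_surjective)
    (hGZ' : GrossZagier1986_thm_I_7_3) (hCT : exists_casselsTate_pairing (K := ℚ))
    (hGZK : rank_eq_analyticRank_of_analyticRank_le_one) (hmod : hasEntireLFunction_rat)
    (hmodD : nonempty_modularParametrizationData) (hX : ClassX4Gord W p)
    (he : semistabilityIndex W p = 2) (hsurj : Surj W p) (hr : W.analyticRank = 1)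
    {Dh : PAdicHeightData W p} (hB : LeadingTermClauses W p Dh) (hrel : ValRelationAt W p Dh)
    {q : ℚ} (hq : shaAn W = (q : ℂ)) (hv : padicValRat p q ≤ 2)
    (hcard : p ^ 2 ∣ Nat.card (W.selmerGroup (p : ℤ))) : BSDp W p := by
  have hp2 : p ≠ 2 := hX.addv.1
  have hS : SchneiderConjecture Dh :=
    schneider_of_valRelationAt hGZ' hGZK hmodD hp2 hX.typeGOrd hX.addv.2 he hr hrel
  rcases mod_four_eq_one_or_three_of_ne_two (p := p) hp2 with h1 | h3
  · exact hX.bsdp_rankOne_of_katoHalf_of_schneider_of_branchPAdicGrossZagier_of_casselsTate_of_sq_dvd_card_selmerGroup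
      hK hCT hGZK hmod hmodD he h1 hsurj hr hB hS
      (branchPAdicGrossZagierAt_of_valRelationAt hGZ' hGZK W hX.addv.2 hr Dh hrel) hq hv hcard
  · exact hX.bsdp_rankOne_of_katoHalf_of_branchPAdicGrossZagierOdd_of_casselsTate_of_sq_dvd_card_selmerGroup
      hK hCT hGZK hmod hmodD he h3 hsurj hr hB hS
      (branchPAdicGrossZagierOddAt_of_valRelationAt hGZ' hGZK W hX.addv.2 hr Dh hrel) hq hv hcard

/-- **(S11-d) at `p = 3`:** X4♯(G-ord)@3 ∧ surj(3), `r_an = 1`, `ord₃ #Ш_an ≤ 2`, `9 ∣ #Sel^(3)(E/ℚ)`,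
the valuation relation at the pair ⟹ `BSD(E,3)` (`e = 2` automatic).
[cite: Kato2004Asterisque, Thm. 17.4 (3) (p. 273)] [cite: GrossZagier1986, Thm. I.(7.3)]
[cite: SilvermanAEC2009, Thm. X.4.14] [cite: Miller2011LMS, Def. 1.1] -/
theorem ClassX4Gord.bsdp_three_rankOne_of_katoHalf_of_censusX42Val_of_casselsTate_of_sq_dvd_card_selmerGroup
    {W : WeierstrassCurve ℚ} [W.IsElliptic] [W.IsGloballyMinimal] [Fact (Nat.Prime 3)]
    (hK : Wuthrich2014.kato_halfEigenCharIdeal_dvd_cyclotomicPrime_of_surjective)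
    (hGZ' : GrossZagier1986_thm_I_7_3) (hCT : exists_casselsTate_pairing (K := ℚ))
    (hGZK : rank_eq_analyticRank_of_analyticRank_le_one) (hmod : hasEntireLFunction_rat)
    (hmodD : nonempty_modularParametrizationData) (hX : ClassX4Gord W 3) (hsurj : Surj W 3)
    (hr : W.analyticRank = 1) {Dh : PAdicHeightData W 3} (hB : LeadingTermClauses W 3 Dh)
    (hrel : ValRelationAt W 3 Dh) {q : ℚ} (hq : shaAn W = (q : ℂ)) (hv : padicValRat 3 q ≤ 2)
    (hcard : 3 ^ 2 ∣ Nat.card (W.selmerGroup (3 : ℤ))) : BSDp W 3 :=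
  ClassX4Gord.bsdp_rankOne_of_katoHalf_of_censusX42Val_of_casselsTate_of_sq_dvd_card_selmerGroup hK hGZ'
    hCT hGZK hmod hmodD hX (semistabilityIndex_eq_two_of_typeG_three W hX.typeGOrd.typeG hX.addv.2) hsurj hr
    hB hrel hq hv (by exact_mod_cast hcard)

end Summit.BirchSwinnertonDyer.Rank1Residual.Additive

namespace Summit.BirchSwinnertonDyer.Rank1Residual.AdditivePotMult

open Additive Supersingular Additive.CensusX42

variable {W : WeierstrassCurve ℚ} [W.IsElliptic] [W.IsGloballyMinimal] {p : ℕ} [hp : Fact p.Prime]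

/-- **(S11-d) X4(M) ∧ surj, `r_an = 1`, every odd `p`, `ord_p #Ш_an(E) ≤ 2`, certificate
`p² ∣ #Sel^(p)(E/ℚ)`, at WINDOW grade:** Kato's half + (B)-datum + the valuation relation at the pair
(`hrel`; rider by `schneider_of_valRelationAt_mult`, branch GZ by `branchPAdicGrossZagierMultAt_of_valRelationAt`)
+ Cassels–Tate + the count ⟹ `BSD(E,p)`. [cite: Kato2004Asterisque, Thm. 17.4 (3) (p. 273)]
[cite: GrossZagier1986, Thm. I.(7.3)] [cite: SilvermanAEC2009, Thm. X.4.14] [cite: Miller2011LMS, Def. 1.1] -/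
theorem ClassX4M.bsdp_rankOne_of_katoHalf_of_censusX42Val_of_casselsTate_of_sq_dvd_card_selmerGroup
    (hK : Wuthrich2014.kato_halfEigenCharIdeal_dvd_cyclotomicPrime_of_surjective)
    (hGZ' : GrossZagier1986_thm_I_7_3) (hCT : exists_casselsTate_pairing (K := ℚ))
    (hGZK : rank_eq_analyticRank_of_analyticRank_le_one) (hmod : hasEntireLFunction_rat)
    (hmodD : nonempty_modularParametrizationData) (hX : ClassX4M W p) (hsurj : Surj W p)
    (hr : W.analyticRank = 1) {Dh : PAdicHeightData W p} (hB : LeadingTermClauses W p Dh)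
    (hrel : ValRelationAt W p Dh) {q : ℚ} (hq : shaAn W = (q : ℂ)) (hv : padicValRat p q ≤ 2)
    (hcard : p ^ 2 ∣ Nat.card (W.selmerGroup (p : ℤ))) : BSDp W p :=
  hX.bsdp_rankOne_of_katoHalf_of_branchPAdicGrossZagierMult_of_casselsTate_of_sq_dvd_card_selmerGroup hK
    hCT hGZK hmod hmodD hsurj hr hB
    (schneider_of_valRelationAt_mult hGZ' hGZK hmodD hX.p_ne_two (ClassX4M.potMult W p hX) hr hrel)
    (branchPAdicGrossZagierMultAt_of_valRelationAt hGZ' hGZK W hX.classX4.2.1 hr Dh hrel) hq hv hcard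

end Summit.BirchSwinnertonDyer.Rank1Residual.AdditivePotMult

end
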